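import Mathlib.Topology.KrullDimension
import Mathlib.Topology.LocallyConstant.Basic
import Mathlib.GroupTheory.Torsion
import Mathlib.Data.Int.WithZero
import Literature.NumberTheory.GaloisRepresentations.Trianguline
import Literature.NumberTheory.GaloisRepresentations.GlobalTriangulineSpace
import Literature.NumberTheory.GaloisRepresentations.CrystallineDeformationRing
import Literature.NumberTheory.GaloisRepresentations.LabelledHodgeTateWeights
import Literature.NumberTheory.GaloisRepresentations.OrdinaryRegular
import Literature.NumberTheory.GaloisRepresentations.AbsGaloisGroupCompact
import HarnessLib

/-!
# The trianguline variety `X_tri^□(ρ̄)` of Breuil–Hellmann–Schraen: the interface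

Definition item `defn-TriangulineVariety` (topic `Literature/NumberTheory/GaloisRepresentations`),
wanted by route `Langlands/TriangulineChamber` to give a signature to its crux `IrredChamberGL2`
(`IRR''`) and to `ChamberQpOpenCases`, `ChamberQpNonsplit`, `OrdinaryComponent`.

## Mathematics (BHS 2017, §2.2)

Let `K/ℚ_p` be finite, `L/ℚ_p` a finite coefficient field containing the `[K:ℚ_p]` embeddings of
`K`, `𝒯 = \widehat{Kˣ}` the rigid space of continuous characters of `Kˣ` and `𝒯_L = 𝒯 ×_{ℚ_p} L`,
`ρ̄ : 𝒢_K → GL_n(k_L)` continuous with a fixed basis, `R^□_ρ̄` its framed deformation ring and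
`𝔛^□_ρ̄ = Spf(R^□_ρ̄)^rig`.  `𝒯_reg ⊂ 𝒯_L` is the complement of the `L`-points `x ↦ x^{-𝐢}` and
`x ↦ x^{1+𝐢}|x|_K`, `𝐢 ∈ ℤ_{≥0}^{Hom(K,L)}` (`x^𝐤 = ∏_τ τ(x)^{k_τ}`, `|·|_K` the normalised absolute
value), and `𝒯ⁿ_reg ⊂ 𝒯ⁿ_L` the Zariski-open of `(δ_1,…,δ_n)` with `δ_iδ_j⁻¹ ∈ 𝒯_reg` for `i ≠ j`.
`U_tri^□(ρ̄)^reg` is the set of points `(x, δ) ∈ 𝔛^□_ρ̄ × 𝒯ⁿ_reg` such that `δ` is a parameter of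
`r_x` (`D_rig^†(r_x)` has an increasing filtration by `(φ, Γ_K)`-stable saturated
`𝓡_{k(x),K}`-submodules with graded pieces `𝓡(δ_1), …, 𝓡(δ_n)`).
[cite: BreuilHellmannSchraen2017Trianguline, §2.2]

* **Déf. 2.4.** The *trianguline variety* `X_tri^□(ρ̄)` is the Zariski closure of
  `U_tri^□(ρ̄)^reg` in `𝔛^□_ρ̄ × 𝒯ⁿ_L` with its reduced structure; `ω' : X_tri^□(ρ̄) → 𝒯ⁿ_L` is the
  second projection. [cite: BreuilHellmannSchraen2017Trianguline, Déf. 2.4]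
* **Th. 2.6.** (i) `X_tri^□(ρ̄)` is equidimensional of dimension `n² + [K:ℚ_p] n(n+1)/2`;
  (ii) `U_tri^□(ρ̄)^reg` is Zariski-open and Zariski-dense in it; (iii) `U_tri^□(ρ̄)^reg` is smooth.
  [cite: BreuilHellmannSchraen2017Trianguline, Th. 2.6]
* Crystalline points: for `r_x` crystalline *generic* (Déf. 2.8: pairwise distinct eigenvalues of
  the linearised crystalline Frobenius and all refinements non-critical) the parameter `δ_x` is
  locally algebraic, strictly dominant, and `x ∈ U_tri^□(ρ̄)^reg` (Lemme 2.11); the *φ-generic*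
  condition of the sequel is `φ_iφ_j⁻¹ ∉ {1, q}` for `i ≠ j`.
  [cite: BreuilHellmannSchraen2017Trianguline, Déf. 2.8 and Lemme 2.11]
  [cite: BreuilHellmannSchraen2019, §1]

## What this file provides (an INTERFACE: no existence statement, no theorem as a field)

Mathlib has no rigid-analytic geometry and the tree has `(φ, Γ)`-modules only as the datum
`PhiGammaModuleData` (file `Trianguline`).  Exactly as the accepted `Eigenvariety`
(`Automorphic/Eigenvariety.lean`) and `PointwiseLiftingRing`/`CrystallineDeformationRing`, this file
fixes the TYPE of the datum "the trianguline variety of `ρ̄`" and the PROPERTIES the genuine object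
enjoys as separate predicates, so that a route states its crux hypothesis-relatively
(`∀ X : TriangulineVariety K p O k ρ̄, X.IsEquidimensional → X.RegularIsOpenDense →
X.PointsOfRegular 𝔇 → … → IRR''(X)`); "the BHS space has these properties" is a construction fact
to be filed when rigid geometry exists.

* `TriangulineVariety K p O k ρ̄` (structure): `Pt` (intended: `X_tri^□(ρ̄)(ℚ̄_p)`) with its
  **analytic Zariski topology** `topology` (closed sets = `ℚ̄_p`-points of closed analytic subsets;
  THE `TopologicalSpace` instance on `Pt`, so that Mathlib's `irreducibleComponents`, `closure`,
  `IsClopen`, `topologicalKrullDim` express irreducible components of the rigid space, cf.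
  [cite: Conrad1999, §2.2]); `galoisRep x = r_x : 𝒢_K →ₜ* GL_n(ℚ̄_p)`, an `O`-integral lift of `ρ̄`
  (`reducesTo`, accepted `ReducesTo O` of `CrystallineDeformationRing` — the same predicate that
  characterises the `ℚ̄_p`-points of Kisin's rings, so that "`X_tri` contains the crystalline
  deformation space" typechecks later); `param x = δ_x ∈ 𝒯ⁿ(ℚ̄_p)` (accepted `CharacterTuple`);
  `injective` (`X_tri^□(ρ̄) ⊂ 𝔛^□_ρ̄ × 𝒯ⁿ`: a point IS the pair `(r_x, δ_x)`);
  `isLocallyConstant_param_torsionType` (the torsion type `δ_x|_{μ(K)ⁿ}` is locally constant: the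
  connected components of `𝒯ⁿ_L` are indexed by `Hom(μ(K)ⁿ, Lˣ)`, `μ(K) = (Kˣ)_tors`, and `ω'` is
  a morphism — requested as a REQUIREMENT by the route, it is what "the components over a type `t`"
  means); `regular ⊆ Pt` (intended `U_tri^□(ρ̄)^reg`).
* Vocabulary on characters of `Kˣ` (definitions with bodies): `CharacterTuple.torsionType`
  (restriction to `μ(K) = CommGroup.torsion Kˣ`); `IsNonarchimedeanLocalField.unitsLogNorm`
  (`x ↦ log_q |x|_K`, `Kˣ →* Multiplicative ℤ`) and `unitsNorm K C : Kˣ →* Cˣ` (`|·|_K` seen in a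
  characteristic-zero field `C`, consistent with the accepted `normAbs`: `normAbs_coe_units`,
  `coe_normAbs_eq_unitsNorm`); `algCharacter 𝐤` (`x ↦ x^𝐤 = ∏_τ τ(x)^{k_τ}`, labels = accepted
  `HodgeTateLabel K C`, continuous embeddings, as in the accepted `ordinaryWeightUnit`);
  `CharacterTuple.IsLocallyAlgebraicOfWeight`, `LabelledWeight.IsStrictlyDominant`,
  `CharacterTuple.IsStrictlyDominant` (`δ` locally algebraic of strictly dominant weight
  `k_{τ,1} > ⋯ > k_{τ,n}`, BHS §2.2); `IsRegularCharacter` (`𝒯_reg`) and `CharacterTuple.IsRegular`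
  (`𝒯ⁿ_reg`).
* `FramedGaloisRep.HasParameter 𝔇 ρ δ` — the LOCAL form of the accepted
  `FramedGaloisRep.HasParameterAt` (file `Trianguline`): the `ℚ̄_p`-valued tuple `δ` is a parameter
  of `ρ : 𝒢_K →ₜ* GL_n(ℚ̄_p)`, i.e. some model over a finite `E/ℚ_p` is trianguline with an
  `E`-valued parameter inducing `δ` (relative to the family `𝔇` of `(φ, Γ_K)`-module data);
  `hasParameterAt_iff_hasParameter_toLocal` (the global notion at `v` IS the local one for
  `ρ|_{𝒢_{K_v}}`, `Iff.rfl`).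
* Point predicates on `x : X.Pt`: `IsCrystallineAt 𝔇` (accepted
  `PstWeilDeligneData.IsCrystallineFramed`),
  `IsHodgeTateRegularAt 𝔇` (pairwise distinct `τ`-labelled Hodge–Tate weights, accepted
  `GaloisRep.IsLabelledHodgeTateRegular`), `IsStrictlyDominantAt` (on `δ_x`), `IsPhiGenericAt 𝔇`
  (`φ`-generic: the geometric Frobenius of the Weil–Deligne representation attached to `r_x` through
  `𝔇` — for crystalline `r_x` the linearised crystalline Frobenius — has pairwise distinct
  eigenvalues with ratios `≠ q^{±1}`), `IsBorelValuedAt d` (`r_x` is conjugate to an upper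
  triangular representation whose ordered diagonal characters `χ_i` satisfy
  `δ_{x,i} ∘ Art_K⁻¹ = χ_i|_{W_K}`, `d : LocalArtinData K` the accepted local Artin datum,
  geometric normalisation as in BHS's `rec_K` — the "Borel-valued lifts with their tautological
  parameter" of the route), `IsSlopeZeroAt` (`δ_{x,1}` is unitary, i.e. `v_p(δ_{x,1}(ϖ_K)) = 0`).
* Properties of `X` (separate predicates): `IsEquidimensional` (Th. 2.6 (i), via
  `topologicalKrullDim` of the irreducible components, as the accepted
  `Eigenvariety.HasNewtonBoundWith`),
  `RegularIsOpenDense` (Th. 2.6 (ii)), `PointsOfRegular 𝔇` and `HasAllRegularPoints 𝔇` (Déf. 2.4: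
  `regular` is exactly the set of pairs `(r, δ)` with `r` a lift of `ρ̄`, `δ ∈ 𝒯ⁿ_reg` a parameter
  of `r`), `BorelLocusClopen d` (the route's support statement `OrdinaryComponent`: the Zariski
  closure `Z_B` of the Borel-valued locus is Zariski clopen — a union of irreducible components
  meeting no other — and equals the slope-zero locus).
* Proved API: the topology instance; type strata `typeStratum t` are clopen and every irreducible
  component lies over a single torsion type
  (`exists_subset_typeStratum_of_mem_irreducibleComponents`
  — what makes "the components over `t`" a partition of the components in the crux); a
  Borel-valued point has unitary parameter, in particular is slope-zero
  (`IsBorelValuedAt.norm_param_eq_one`, `IsBorelValuedAt.isSlopeZeroAt`: compactness of `𝒢_K`, the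
  inclusion `Z_B ⊆ {slope 0}` of `OrdinaryComponent`); unfolding lemmas.

With it the crux `IRR''` reads, for `ρ̄ : ModPGaloisRep K k 2` and a torsion type `t`:
`{C ∈ irreducibleComponents X.Pt | C ⊆ X.typeStratum t ∧ ¬ C ⊆ closure {x | X.IsBorelValuedAt d x} ∧
  ∃ x ∈ C ∩ X.regular, X.IsCrystallineAt 𝔇 x ∧ X.IsHodgeTateRegularAt 𝔇 x ∧
  X.IsStrictlyDominantAt x ∧ X.IsPhiGenericAt 𝔇 x}.Subsingleton`.

## Design notes

* **Points over `ℚ̄_p`, coefficients `O`.**  As in `PointwiseLiftingRing` ([BLGGT] convention) a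
  point carries `r_x : 𝒢_K → GL_n(𝒪_{ℚ̄_p})` reducing to `ρ̄` through the coefficient ring `O`
  (intended `O = 𝒪_L ⊆ ℚ̄_p`, `k = k_L`; `ReducesTo O`), rather than an `L'`-valued representation
  for varying finite `L'/L`; working over `ℚ̄_p` also renders "`L` large enough" (geometric
  irreducible components), as the route's refuters asked.  A consumer binds the coefficients as the
  accepted `PstWeilDeligneData.HasCrystallineDeformationRings` does: `L : IntermediateField ℚ_[p]
  (PadicAlgCl p)` finite over `ℚ_p`, `O := intermediateFieldIntegers p L` with
  `letI := intermediateFieldIntegers.algebraPadicAlgCl L`, `k := IsLocalRing.ResidueField O` with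
  the discrete topology — then the `ℚ̄_p`-points of Kisin's crystalline deformation rings of `ρ̄`
  and the points of `X : TriangulineVariety K p O k ρ̄` speak about the same lifts (`ReducesTo O`).
* **No `Algebra ℚ_[p] K` instance is assumed by the structure** (Mathlib completions have none);
  labels are the accepted `HodgeTateLabel K C` (continuous embeddings, `= Hom_{ℚ_p}(K, ℚ̄_p)` for
  `p`-adic `K`); the two predicates that need `[K:ℚ_p]` or `ℚ_p`-algebra embeddings
  (`IsEquidimensional`, `IsHodgeTateRegularAt`) take the structure from an instance argument resp.
  from the datum `𝔇.algebra`, as the summit statement does (`letI := D.algebra`).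
* **Indices.** Lean's `i : Fin n` is the printed `i + 1`; `δ_{x,1} = param x 0` is the character of
  the rank-one SUB-object `𝓡(δ_1) = Fil¹` (increasing filtration, BHS), matching the accepted
  `IsTriangularWith` (upper triangular matrices: `e_0` spans the stable line) and
  `FramedRep.IsUpperTriangular` / `diagEntry 0` (the `𝒢_K`-stable line of a Borel-valued `r`).
* **Slope zero as unitarity.** `v_p(δ(ϖ_K)) = 0` is rendered as "`δ` takes values of norm one":
  for a continuous `δ` the two agree (`δ(𝒪_Kˣ)` is a compact subgroup of `ℚ̄_pˣ`, hence of norm one,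
  and `Kˣ = ϖ^ℤ × 𝒪_Kˣ`), and no uniformiser needs choosing.
* Deliberately NOT here: the weight map `ω` and Sen weights (Prop. 2.9), smoothness (Th. 2.6 (iii)),
  accumulation/companion points, the patched eigenvariety `X_p(ρ̄)` (§3), and any named existence
  fact (over an interface it would be vacuous: `Pt = ∅` has every property; the meaningful
  statement is the route's hypothesis-relative crux).

## References

* C. Breuil, E. Hellmann, B. Schraen, *Une interprétation modulaire de la variété trianguline*,
  Math. Ann. 367 (2017), arXiv:1411.7260: Notations (p. 4: `|·|_K`, `rec_K`), §2.1 (Déf. 2.1–2.2),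
  §2.2 (Déf. 2.4, Rem. 2.5, Th. 2.6, Déf. 2.8, Prop. 2.9, Lemme 2.11).
  [BreuilHellmannSchraen2017Trianguline]
* C. Breuil, E. Hellmann, B. Schraen, *A local model for the trianguline variety and applications*,
  Publ. Math. IHÉS 130 (2019), arXiv:1702.02192, §1 (crystalline `φ`-generic points).
  [BreuilHellmannSchraen2019]
* K. S. Kedlaya, J. Pottharst, L. Xiao, *Cohomology of arithmetic families of `(φ, Γ)`-modules*,
  JAMS 27 (2014), Def. 6.3.1 (parameters), Thm. 6.3.13. [KedlayaPottharstXiao2014]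
* D. Hansen, *Universal eigenvarieties, trianguline Galois representations, and `p`-adic Langlands
  functoriality*, Crelle 730 (2017), §1.2. [HansenUniversalEigenvarieties2017]
* B. Conrad, *Irreducible components of rigid spaces*, Ann. Inst. Fourier 49 (1999), §2.2.
  [Conrad1999]
-/

noncomputable section

open scoped NumberField NNReal Topology
open Field IsDedekindDomain Filter

namespace Literature.NumberTheory.GaloisRepresentations

universe u v

/-! ### Torsion types of character tuples -/

section TorsionType

variable {F : Type u} [Field F] [TopologicalSpace F] {C : Type v} [CommRing C] [TopologicalSpace C]
  {n : ℕ}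

/-- The **torsion type** of `δ = (δ_1, …, δ_n) ∈ 𝒯ⁿ(C)`: the restrictions `δ_i|_{μ(F)}` to the
torsion subgroup `μ(F) = (Fˣ)_tors` (Mathlib `CommGroup.torsion Fˣ`; for a `p`-adic field the finite
cyclic group of roots of unity of `F`).  For `L` large the connected components of the character
space `𝒯ⁿ_L` of `(Fˣ)ⁿ` are indexed by `Hom(μ(F)ⁿ, Lˣ)` (`Fˣ ≅ ϖ^ℤ × μ(F) × ℤ_p^{[F:ℚ_p]}`), and the
route `TriangulineChamber` calls this index the type `t` of a point of the trianguline variety.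
[cite: BreuilHellmannSchraen2017Trianguline, §2.2] -/
def CharacterTuple.torsionType (δ : CharacterTuple F C n) (i : Fin n) :
    CommGroup.torsion Fˣ →* Cˣ :=
  (δ i).toMonoidHom.restrict (CommGroup.torsion Fˣ)

/-- Unfolding lemma: the torsion type is the restriction of `δ_i` to `μ(F)`. [folklore] -/
@[simp] lemma CharacterTuple.torsionType_apply (δ : CharacterTuple F C n) (i : Fin n)
    (ζ : CommGroup.torsion Fˣ) : δ.torsionType i ζ = δ i ζ := rfl

end TorsionType

/-! ### Algebraic and locally algebraic characters of `Fˣ`; strictly dominant weights -/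

section Algebraic

variable {F : Type u} [Field F] [TopologicalSpace F] {C : Type v} [CommRing C] [TopologicalSpace C]
  {n : ℕ}

/-- The **algebraic character `x ↦ x^𝐤 = ∏_τ τ(x)^{k_τ}`** of `Fˣ` attached to an integer vector
`𝐤 = (k_τ)_τ` indexed by the labels `τ : F → C` (accepted `HodgeTateLabel F C`: continuous ring
embeddings; for `F/ℚ_p` finite and `C = ℚ̄_p` these are the `[F:ℚ_p]` embeddings `Hom(F, L)` of
BHS).  A `finprod` over the labels (finitely many in the intended case; junk value `1` otherwise),
exactly as the accepted `ordinaryWeightUnit`. [cite: BreuilHellmannSchraen2017Trianguline, §2.2] -/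
def algCharacter (wt : HodgeTateLabel F C → ℤ) (x : Fˣ) : Cˣ :=
  ∏ᶠ τ : HodgeTateLabel F C, Units.map (τ : F →* C) x ^ wt τ

/-- Unfolding lemma for `algCharacter`. [folklore] -/
lemma algCharacter_apply (wt : HodgeTateLabel F C → ℤ) (x : Fˣ) :
    algCharacter wt x = ∏ᶠ τ : HodgeTateLabel F C, Units.map (τ : F →* C) x ^ wt τ := rfl

/-- `x^0 = 1`. [folklore] -/
@[simp] lemma algCharacter_zero (x : Fˣ) :
    algCharacter (fun _ : HodgeTateLabel F C => (0 : ℤ)) x = 1 := by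
  simp [algCharacter]

/-- `1^𝐤 = 1`. [folklore] -/
@[simp] lemma algCharacter_one (wt : HodgeTateLabel F C → ℤ) : algCharacter wt (1 : Fˣ) = 1 := by
  simp [algCharacter]

/-- `δ = (δ_i) ∈ 𝒯ⁿ(C)` is **locally algebraic of weight `𝐤 = (k_{τ,i})`**: each `δ_i` coincides
with the algebraic character `x ↦ ∏_τ τ(x)^{k_{τ,i}}` on a neighbourhood of `1` in `Fˣ`
(equivalently on an open subgroup of `𝒪_Fˣ`; i.e. the weights `ω_τ(δ_i)` of BHS, defined through
the differential of `δ_i` at `1`, are the integers `k_{τ,i}` and `δ_i` is locally algebraic).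
Lean's `wt τ i` is the printed `k_{τ,i+1}`.
[cite: BreuilHellmannSchraen2017Trianguline, §2.2 (`δ_𝐤`) and Lemme 2.11] -/
def CharacterTuple.IsLocallyAlgebraicOfWeight (δ : CharacterTuple F C n)
    (wt : LabelledWeight F C n) : Prop :=
  ∀ i : Fin n, ∀ᶠ u in 𝓝 (1 : Fˣ), δ i u = algCharacter (fun τ => wt τ i) u

/-- The weight `𝐤 = (k_{τ,i})` is **strictly dominant**: `k_{τ,1} > k_{τ,2} > ⋯ > k_{τ,n}` for every
label `τ` (BHS §2.2: "si de plus … `k_{τ,1} > ⋯ > k_{τ,n}`, on dit que le poids est strictement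
dominant"; compare the accepted `LabelledWeight.IsDominant`, `≥`).
[cite: BreuilHellmannSchraen2017Trianguline, §2.2] -/
def LabelledWeight.IsStrictlyDominant (wt : LabelledWeight F C n) : Prop :=
  ∀ τ : HodgeTateLabel F C, StrictAnti (wt τ)

/-- A strictly dominant weight is dominant. [folklore] -/
lemma LabelledWeight.IsStrictlyDominant.isDominant {wt : LabelledWeight F C n}
    (h : wt.IsStrictlyDominant) : wt.IsDominant :=
  fun τ => (h τ).antitone

/-- `δ ∈ 𝒯ⁿ(C)` is **locally algebraic of strictly dominant weight** ("`δ_x` est localement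
algébrique, strictement dominant", the conclusion of BHS Lemme 2.11 for crystalline generic points;
the "crystalline strictly dominant" points of the sequel).
[cite: BreuilHellmannSchraen2017Trianguline, §2.2 and Lemme 2.11] -/
def CharacterTuple.IsStrictlyDominant (δ : CharacterTuple F C n) : Prop :=
  ∃ wt : LabelledWeight F C n, wt.IsStrictlyDominant ∧ δ.IsLocallyAlgebraicOfWeight wt

/-- Unfolding lemma for `CharacterTuple.IsStrictlyDominant`. [folklore] -/
lemma CharacterTuple.isStrictlyDominant_iff (δ : CharacterTuple F C n) :
    δ.IsStrictlyDominant ↔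
      ∃ wt : LabelledWeight F C n, (∀ τ, StrictAnti (wt τ)) ∧
        ∀ i : Fin n, ∀ᶠ u in 𝓝 (1 : Fˣ), δ i u = algCharacter (fun τ => wt τ i) u :=
  Iff.rfl

end Algebraic

/-! ### The normalised absolute value of a local field on units, with values in `ℤ` and in `C` -/

namespace IsNonarchimedeanLocalField

open ValuativeRel

section LogNorm

variable (F : Type u) [Field F] [ValuativeRel F] [TopologicalSpace F] [IsNonarchimedeanLocalField F]

/-- **`x ↦ log_q |x|_F`** on `Fˣ`, as a homomorphism `Fˣ →* Multiplicative ℤ`: the canonical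
valuation of `x` read in `ℤᵐ⁰` through Mathlib's
`IsNonarchimedeanLocalField.valueGroupWithZeroIsoInt` (the normalisation of the accepted `normAbs`:
`|x|_F = q_F ^ (log_q |x|_F)`, `normAbs_coe_units`; a uniformiser goes to `-1`).
[cite: BreuilHellmannSchraen2017Trianguline, Notations (p. 4)] -/
def unitsLogNorm : Fˣ →* Multiplicative ℤ :=
  (WithZero.unitsWithZeroEquiv (α := Multiplicative ℤ)).toMonoidHom.comp
    (Units.map
      ((_root_.IsNonarchimedeanLocalField.valueGroupWithZeroIsoInt
            F).toMulEquiv.toMonoidWithZeroHom.comp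
        (valuation F).toMonoidWithZeroHom).toMonoidHom)

/-- `unitsLogNorm x`, coerced back into `ℤᵐ⁰`, is the (integer-normalised) valuation of `x`.
[folklore] -/
lemma coe_unitsLogNorm (x : Fˣ) :
    ((unitsLogNorm F x : Multiplicative ℤ) : WithZero (Multiplicative ℤ)) =
      _root_.IsNonarchimedeanLocalField.valueGroupWithZeroIsoInt F (valuation F (x : F)) :=
  WithZero.coe_unzero _

/-- **Consistency with the accepted normalised absolute value**: `|x|_F = q_F ^ (log_q |x|_F)` for
`x ∈ Fˣ` (`normAbs` of `LocalField.lean`). [folklore] -/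
lemma normAbs_coe_units (x : Fˣ) :
    normAbs F (x : F) = (residueFieldCard F : ℝ≥0) ^ Multiplicative.toAdd (unitsLogNorm F x) := by
  have hx :
      _root_.IsNonarchimedeanLocalField.valueGroupWithZeroIsoInt F (valuation F (x : F)) ≠ 0 := by
    rw [← coe_unitsLogNorm]
    exact WithZero.coe_ne_zero
  have h2 : WithZero.unzero hx = unitsLogNorm F x :=
    WithZero.coe_injective (by rw [WithZero.coe_unzero, coe_unitsLogNorm])
  rw [normAbs_apply, WithZeroMulInt.toNNReal_neg_apply _ hx, h2]

variable (C : Type v) [Field C] [CharZero C]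

/-- `q_F ≠ 0` in a field of characteristic zero. [folklore] -/
lemma residueFieldCard_cast_ne_zero : (residueFieldCard F : C) ≠ 0 := by
  exact_mod_cast residueFieldCard_ne_zero F

/-- **The normalised absolute value `|·|_F` with values in `Cˣ`**, `C` a field of characteristic
zero (intended `C = ℚ̄_p` or a finite `L/ℚ_p`): `x ↦ q_F ^ (log_q |x|_F)`, a homomorphism
`Fˣ →* Cˣ` (`|ϖ|_F = q_F⁻¹`; this is the character `|·|_K ∈ 𝒯(L)` entering `𝒯_reg`).
[cite: BreuilHellmannSchraen2017Trianguline, Notations (p. 4) and §2.2] -/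
def unitsNorm : Fˣ →* Cˣ :=
  (zpowersHom Cˣ (Units.mk0 (residueFieldCard F : C) (residueFieldCard_cast_ne_zero F C))).comp
    (unitsLogNorm F)

/-- The value of `unitsNorm`: `|x|_F = q_F ^ (log_q |x|_F)` in `C`. [folklore] -/
lemma val_unitsNorm_apply (x : Fˣ) :
    (unitsNorm F C x : C) = (residueFieldCard F : C) ^ Multiplicative.toAdd (unitsLogNorm F x) := by
  simp [unitsNorm, Units.val_zpow_eq_zpow_val]

/-- **Consistency**: in `C = ℝ` the `C`-valued absolute value is the accepted `normAbs`.
[folklore] -/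
lemma coe_normAbs_eq_unitsNorm (x : Fˣ) :
    ((normAbs F (x : F) : ℝ≥0) : ℝ) = (unitsNorm F ℝ x : ℝ) := by
  rw [normAbs_coe_units, val_unitsNorm_apply]
  push_cast
  rfl

end LogNorm

end IsNonarchimedeanLocalField

/-! ### Regular characters: `𝒯_reg` and `𝒯ⁿ_reg` -/

section Regular

variable {F : Type u} [Field F] [ValuativeRel F] [TopologicalSpace F] [IsNonarchimedeanLocalField F]
  {C : Type v} [Field C] [CharZero C] [TopologicalSpace C] {n : ℕ}

/-- `η ∈ 𝒯(C)` is **regular**, `η ∈ 𝒯_reg`: `η` is none of the characters `x ↦ x^{-𝐢}` and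
`x ↦ x^{1+𝐢}|x|_F` for `𝐢 ∈ ℤ_{≥0}^{labels}` (`x^𝐤 = algCharacter 𝐤 x`, `|·|_F = unitsNorm F C`).
"On note `𝒯_reg` le complémentaire dans `𝒯_L` de l'ensemble des `L`-points `x ↦ x^{-𝐢}` et
`x ↦ x^{1+𝐢}|x|_K` pour `𝐢 ∈ ℤ_{≥0}^{Hom(K,L)}`."
[cite: BreuilHellmannSchraen2017Trianguline, §2.2] -/
def IsRegularCharacter (η : Fˣ →ₜ* Cˣ) : Prop :=
  ∀ wt : HodgeTateLabel F C → ℕ,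
    (⇑η ≠ fun x => algCharacter (fun τ => -(wt τ : ℤ)) x) ∧
      (⇑η ≠ fun x =>
        IsNonarchimedeanLocalField.unitsNorm F C x * algCharacter (fun τ => 1 + (wt τ : ℤ)) x)

variable [IsTopologicalRing C]

/-- `δ = (δ_1, …, δ_n) ∈ 𝒯ⁿ(C)` is **regular**, `δ ∈ 𝒯ⁿ_reg`: `δ_iδ_j⁻¹ ∈ 𝒯_reg` for all `i ≠ j`
(a Zariski-open condition on `𝒯ⁿ_L`). [cite: BreuilHellmannSchraen2017Trianguline, §2.2] -/
def CharacterTuple.IsRegular (δ : CharacterTuple F C n) : Prop :=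
  ∀ i j : Fin n, i ≠ j → IsRegularCharacter (δ i * (δ j)⁻¹)

/-- Unfolding lemma for `CharacterTuple.IsRegular`. [folklore] -/
lemma CharacterTuple.isRegular_iff (δ : CharacterTuple F C n) :
    δ.IsRegular ↔ ∀ i j : Fin n, i ≠ j → IsRegularCharacter (δ i * (δ j)⁻¹) := Iff.rfl

/-- In rank `≤ 1` every tuple is regular (there is no pair `i ≠ j`). [folklore] -/
lemma CharacterTuple.isRegular_of_subsingleton [Subsingleton (Fin n)] (δ : CharacterTuple F C n) :
    δ.IsRegular :=
  fun i j hij => absurd (Subsingleton.elim i j) hij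

omit [IsTopologicalRing C] in
/-- The trivial character is not regular: it is `x ↦ x^{-𝐢}` for `𝐢 = 0` (sanity check of the
orientation of `𝒯_reg`). [folklore] -/
lemma not_isRegularCharacter_one : ¬ IsRegularCharacter (1 : Fˣ →ₜ* Cˣ) := fun h =>
  (h fun _ => 0).1 (funext fun x => by simp [algCharacter])

/-- **A regular tuple consists of pairwise distinct characters** (`δ_iδ_j⁻¹ = 1 ∉ 𝒯_reg`).
[folklore] -/
theorem CharacterTuple.IsRegular.injective {δ : CharacterTuple F C n} (h : δ.IsRegular) :
    Function.Injective δ := by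
  intro i j hij
  by_contra hne
  have h1 := h i j hne
  rw [hij, mul_inv_cancel] at h1
  exact not_isRegularCharacter_one h1

end Regular

/-! ### Local parameters of `ℚ̄_p`-representations (`δ` is a parameter of `ρ : 𝒢_K → GL_n(ℚ̄_p)`) -/

namespace FramedGaloisRep

section LocalParameter

variable {K : Type} [Field K] [TopologicalSpace K] {p : ℕ} [Fact p.Prime] {n : ℕ}

/-- **`δ ∈ 𝒯ⁿ(ℚ̄_p)` is a parameter of `ρ : 𝒢_K →ₜ* GL_n(ℚ̄_p)`** (local form of the accepted
`HasParameterAt`), relative to a family `𝔇` of `(φ, Γ_K)`-module data over the finite `E ⊆ ℚ̄_p`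
(intended: the Robba rings `𝓡_{E,K}` with `D_rig^†`, `PhiGammaModuleData.nonempty`): some model
`rE` of `ρ` over a finite `E/ℚ_p` (accepted `HasQlModel`) is trianguline with an `E`-valued ordered
parameter `δE` (accepted `IsTriangulineWith`: `D_rig^†(rE)` has an increasing filtration by
`(φ, Γ_K)`-stable free direct summands with graded pieces `𝓡(δE_1), …, 𝓡(δE_n)`) whose composite
with `E ⊆ ℚ̄_p` is `δ`.  This is "`δ` est un système de paramètres de `r_x`" of BHS §2.2 (with
`k(x) ⊆ ℚ̄_p`), KPX Def. 6.3.1 ("after perhaps enlarging `L`").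
[cite: BreuilHellmannSchraen2017Trianguline, §2.2] [cite: KedlayaPottharstXiao2014, Def. 6.3.1] -/
def HasParameter
    (𝔇 : ∀ E : IntermediateField ℚ_[p] (PadicAlgCl p), FiniteDimensional ℚ_[p] E →
      PhiGammaModuleData.{0, 0, 0} p K E)
    (ρ : FramedGaloisRep K (PadicAlgCl p) n) (δ : CharacterTuple K (PadicAlgCl p) n) : Prop :=
  ∃ (E : IntermediateField ℚ_[p] (PadicAlgCl p)) (hE : FiniteDimensional ℚ_[p] E)
    (rE : FramedGaloisRep K E n) (δE : Fin n → (Kˣ →ₜ* Eˣ)),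
    Literature.NumberTheory.Automorphic.HasQlModel ρ E rE ∧ rE.IsTriangulineWith (𝔇 E hE) δE ∧
      ∀ (i : Fin n) (x : Kˣ),
        ((δ i x : (PadicAlgCl p)ˣ) : PadicAlgCl p) = algebraMap E (PadicAlgCl p) (δE i x : Eˣ)

/-- Unfolding lemma for `HasParameter`. [folklore] -/
lemma hasParameter_iff
    (𝔇 : ∀ E : IntermediateField ℚ_[p] (PadicAlgCl p), FiniteDimensional ℚ_[p] E →
      PhiGammaModuleData.{0, 0, 0} p K E)
    (ρ : FramedGaloisRep K (PadicAlgCl p) n) (δ : CharacterTuple K (PadicAlgCl p) n) :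
    HasParameter 𝔇 ρ δ ↔
      ∃ (E : IntermediateField ℚ_[p] (PadicAlgCl p)) (hE : FiniteDimensional ℚ_[p] E)
        (rE : FramedGaloisRep K E n) (δE : Fin n → (Kˣ →ₜ* Eˣ)),
        Literature.NumberTheory.Automorphic.HasQlModel ρ E rE ∧ rE.IsTriangulineWith (𝔇 E hE) δE ∧
          ∀ (i : Fin n) (x : Kˣ),
            ((δ i x : (PadicAlgCl p)ˣ) : PadicAlgCl p) =
              algebraMap E (PadicAlgCl p) (δE i x : Eˣ) :=
  Iff.rfl

end LocalParameter

section GlobalLocal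

variable {K : Type} [Field K] [NumberField K] {p : ℕ} [Fact p.Prime] {n : ℕ}

/-- **Global = local.**  For a number field `K`, `ρ : 𝒢_K →ₜ* GL_n(ℚ̄_p)` and a finite place `v`,
the accepted `ρ.HasParameterAt v 𝔇 δ` ("`δ` is a parameter of `ρ` at `v`", Hansen §1.2) is literally
`HasParameter 𝔇 (ρ|_{𝒢_{K_v}}) δ`. [cite: HansenUniversalEigenvarieties2017, §1.2] -/
theorem hasParameterAt_iff_hasParameter_toLocal (v : HeightOneSpectrum (𝓞 K))
    (𝔇 : ∀ E : IntermediateField ℚ_[p] (PadicAlgCl p), FiniteDimensional ℚ_[p] E →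
      PhiGammaModuleData.{0, 0, 0} p (v.adicCompletion K) E)
    (ρ : FramedGaloisRep K (PadicAlgCl p) n)
    (δ : CharacterTuple (v.adicCompletion K) (PadicAlgCl p) n) :
    ρ.HasParameterAt v 𝔇 δ ↔ HasParameter 𝔇 (ρ.toLocal v) δ :=
  Iff.rfl

end GlobalLocal

end FramedGaloisRep

/-! ### The trianguline variety: the datum -/

/-- **The trianguline variety `X_tri^□(ρ̄)` of Breuil–Hellmann–Schraen — interface.**  Parameters: a
non-archimedean local field `K` (intended `K/ℚ_p` finite), the prime `p`, a coefficient ring `O`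
with its maps to `ℚ̄_p` and to the residue field `k` (intended `O = 𝒪_L ⊆ ℚ̄_p`, `k = k_L`, for the
finite `L/ℚ_p` over which BHS work), and the residual representation `ρ̄ : 𝒢_K →ₜ* GL_n(k)` with
its fixed basis (accepted `ModPGaloisRep`).  Fields — the arithmetic shadow of the reduced rigid
space `X_tri^□(ρ̄) ⊂ 𝔛^□_ρ̄ × 𝒯ⁿ_L`, the Zariski closure of `U_tri^□(ρ̄)^reg` (BHS Déf. 2.4):
* `Pt` — its `ℚ̄_p`-points — with `topology`, the **analytic Zariski topology** (closed subsets =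
  the points of closed analytic subsets, BHS Déf. 2.1), registered as THE topology of `Pt`, so that
  irreducible components (Conrad), Zariski closures and dimensions are Mathlib's
  `irreducibleComponents`, `closure`, `topologicalKrullDim`;
* `galoisRep x = r_x : 𝒢_K →ₜ* GL_n(ℚ̄_p)`, the framed lift of `ρ̄` underlying `x`
  (`reducesTo`: `r_x` is `O`-integral and reduces to `ρ̄` — a `ℚ̄_p`-point of `𝔛^□_ρ̄`, accepted
  `ReducesTo`), and `param x = δ_x = ω'(x) ∈ 𝒯ⁿ(ℚ̄_p)` (accepted `CharacterTuple`);
* `injective`: `x ↦ (r_x, δ_x)` is injective (`X_tri^□(ρ̄)` is a subspace of `𝔛^□_ρ̄ × 𝒯ⁿ_L`);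
* `isLocallyConstant_param_torsionType`: the torsion type `δ_x|_{μ(K)ⁿ}`
  (`CharacterTuple.torsionType`) is locally constant — the strata `X_t` over the connected
  components `𝒯ⁿ_t` of `𝒯ⁿ_L` are Zariski open and closed (required by the requesting route:
  "chamber over a type `t`");
* `regular ⊆ Pt` (intended: `U_tri^□(ρ̄)^reg`).
No theorem and no existence statement is a field: Th. 2.6 and the description of `regular` are the
predicates `IsEquidimensional`, `RegularIsOpenDense`, `PointsOfRegular`, `HasAllRegularPoints`
below, and "the genuine `X_tri^□(ρ̄)` is such a datum with these properties" is a separate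
construction statement (rigid geometry is absent from Mathlib).
[cite: BreuilHellmannSchraen2017Trianguline, Déf. 2.4 and Th. 2.6] -/
structure TriangulineVariety (K : Type) [Field K] [ValuativeRel K] [TopologicalSpace K]
    [IsNonarchimedeanLocalField K] (p : ℕ) [Fact p.Prime] (O : Type) [CommRing O]
    [Algebra O (PadicAlgCl p)] (k : Type) [Field k] [Algebra O k] [TopologicalSpace k] {n : ℕ}
    (ρbar : ModPGaloisRep K k n) : Type 1 where
  /-- The `ℚ̄_p`-points `X_tri^□(ρ̄)(ℚ̄_p)`. -/
  Pt : Type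
  /-- The analytic Zariski topology on the points. -/
  topology : TopologicalSpace Pt
  /-- `r_x : 𝒢_K →ₜ* GL_n(ℚ̄_p)`, the framed Galois representation at `x` (first projection to
  `𝔛^□_ρ̄`). -/
  galoisRep : Pt → FramedGaloisRep K (PadicAlgCl p) n
  /-- `δ_x ∈ 𝒯ⁿ(ℚ̄_p)`, the parameter at `x` (second projection `ω'` to `𝒯ⁿ_L`). -/
  param : Pt → CharacterTuple K (PadicAlgCl p) n
  /-- Every `r_x` is an `O`-integral lift of `ρ̄` (a `ℚ̄_p`-point of `𝔛^□_ρ̄`). -/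
  reducesTo : ∀ x : Pt, ReducesTo O (galoisRep x).toMonoidHom ρbar.toMonoidHom
  /-- A point is determined by `(r_x, δ_x)`: `X_tri^□(ρ̄) ⊂ 𝔛^□_ρ̄ × 𝒯ⁿ_L`. -/
  injective : Function.Injective fun x : Pt => (galoisRep x, param x)
  /-- The torsion type `δ_x|_{μ(K)ⁿ}` is locally constant for the analytic Zariski topology. -/
  isLocallyConstant_param_torsionType : IsLocallyConstant fun x : Pt => (param x).torsionType
  /-- The regular locus (intended: `U_tri^□(ρ̄)^reg`). -/
  regular : Set Pt

namespace TriangulineVariety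

variable {K : Type} [Field K] [ValuativeRel K] [TopologicalSpace K] [IsNonarchimedeanLocalField K]
  {p : ℕ} [Fact p.Prime] {O : Type} [CommRing O] [Algebra O (PadicAlgCl p)] {k : Type} [Field k]
  [Algebra O k] [TopologicalSpace k] {n : ℕ} {ρbar : ModPGaloisRep K k n}
  (X : TriangulineVariety K p O k ρbar)

/-- The analytic Zariski topology on the points of a trianguline-variety datum (the structure field
`topology`, registered for instance search on the new type `X.Pt`; it overrides nothing).
[folklore] -/
instance instTopologicalSpacePt : TopologicalSpace X.Pt := X.topology

/-! #### Torsion types and type strata -/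

/-- The **torsion type** `t(x) = δ_x|_{μ(K)ⁿ} ∈ Hom(μ(K), ℚ̄_pˣ)ⁿ` of a point (the connected
component of `𝒯ⁿ_L` over which `x` lies). [cite: BreuilHellmannSchraen2017Trianguline, §2.2] -/
def torsionType (x : X.Pt) : Fin n → (CommGroup.torsion Kˣ →* (PadicAlgCl p)ˣ) :=
  (X.param x).torsionType

/-- Unfolding lemma for `torsionType`. [folklore] -/
@[simp] lemma torsionType_apply (x : X.Pt) (i : Fin n) (ζ : CommGroup.torsion Kˣ) :
    X.torsionType x i ζ = X.param x i ζ := rfl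

/-- The torsion type is locally constant (structure field `isLocallyConstant_param_torsionType`).
[folklore] -/
lemma isLocallyConstant_torsionType : IsLocallyConstant X.torsionType :=
  X.isLocallyConstant_param_torsionType

/-- The **type stratum** `X_t = {x | t(x) = t}`: the part of `X_tri^□(ρ̄)` over the component
`𝒯ⁿ_t` of the character space (the union of the irreducible components of type `t`, see
`exists_subset_typeStratum_of_mem_irreducibleComponents`). [folklore] -/
def typeStratum (t : Fin n → (CommGroup.torsion Kˣ →* (PadicAlgCl p)ˣ)) : Set X.Pt :=
  X.torsionType ⁻¹' {t}

/-- Membership in a type stratum. [folklore] -/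
@[simp] lemma mem_typeStratum_iff (t : Fin n → (CommGroup.torsion Kˣ →* (PadicAlgCl p)ˣ))
    (x : X.Pt) : x ∈ X.typeStratum t ↔ X.torsionType x = t := Iff.rfl

/-- **Type strata are Zariski open and closed** (from local constancy of the type). [folklore] -/
theorem isClopen_typeStratum (t : Fin n → (CommGroup.torsion Kˣ →* (PadicAlgCl p)ˣ)) :
    IsClopen (X.typeStratum t) :=
  X.isLocallyConstant_torsionType.isClopen_fiber t

/-- A preirreducible (hence preconnected) set of points lies over a single torsion type.
[folklore] -/
theorem exists_subset_typeStratum_of_isPreirreducible {C : Set X.Pt} (hC : IsPreirreducible C) :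
    ∃ t, C ⊆ X.typeStratum t := by
  rcases C.eq_empty_or_nonempty with rfl | ⟨x, hx⟩
  · exact ⟨fun _ => 1, Set.empty_subset _⟩
  · exact ⟨X.torsionType x, fun y hy =>
      X.isLocallyConstant_torsionType.apply_eq_of_isPreconnected hC.isPreconnected hy hx⟩

/-- **Every irreducible component of `X_tri^□(ρ̄)` lies over a single torsion type `t`** — so the
families "irreducible components `C ⊆ X_t`", `t ∈ Hom(μ(K), ℚ̄_pˣ)ⁿ`, partition the set of
irreducible components (the indexation used by the crux `IRR''`). [folklore] -/
theorem exists_subset_typeStratum_of_mem_irreducibleComponents {C : Set X.Pt}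
    (hC : C ∈ irreducibleComponents X.Pt) : ∃ t, C ⊆ X.typeStratum t :=
  X.exists_subset_typeStratum_of_isPreirreducible hC.1.isPreirreducible

/-! #### Predicates on points -/

section PointPredicates

/-- **`x` is crystalline**: `r_x` is crystalline, read through the `p`-adic Hodge datum `𝔇`
(accepted `PstWeilDeligneData.IsCrystallineFramed`: de Rham with unramified Weil–Deligne
representation and `N = 0` — the summit statement's phrasing of "crystalline at `v ∣ p`").
[cite: BreuilHellmannSchraen2017Trianguline, §2.2 (points cristallins) and Lemme 2.11] -/
def IsCrystallineAt (𝔇 : PstWeilDeligneData K p) (x : X.Pt) : Prop :=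
  𝔇.IsCrystallineFramed (X.galoisRep x)

/-- Unfolding lemma for `IsCrystallineAt`. [folklore] -/
lemma isCrystallineAt_iff (𝔇 : PstWeilDeligneData K p) (x : X.Pt) :
    X.IsCrystallineAt 𝔇 x ↔ 𝔇.IsCrystallineFramed (X.galoisRep x) := Iff.rfl

/-- **`x` is Hodge–Tate regular**: for every `ℚ_p`-embedding `τ : K → ℚ̄_p` the `τ`-labelled
Hodge–Tate weights of `r_x` are pairwise distinct (accepted `GaloisRep.IsLabelledHodgeTateRegular`,
relative to the period ring `𝔇.𝔅` and the `ℚ_p`-algebra structure `𝔇.algebra` of the datum, as in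
the summit statement) — "the Hodge–Tate weights of `ρ` at places above `p` are regular".
[cite: BreuilHellmannSchraen2019, §1] -/
def IsHodgeTateRegularAt (𝔇 : PstWeilDeligneData K p) (x : X.Pt) : Prop :=
  letI := 𝔇.algebra
  GaloisRep.IsLabelledHodgeTateRegular 𝔇.𝔅 (X.galoisRep x).toGaloisRep

/-- **`x` is strictly dominant**: its parameter `δ_x` is locally algebraic of strictly dominant
weight (`CharacterTuple.IsStrictlyDominant`; for `r_x` crystalline generic this holds and
`x ∈ U_tri^□(ρ̄)^reg`, BHS Lemme 2.11; these are the non-critical classical points, as opposed to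
their companion points). [cite: BreuilHellmannSchraen2017Trianguline, Lemme 2.11] -/
def IsStrictlyDominantAt (x : X.Pt) : Prop :=
  (X.param x).IsStrictlyDominant

/-- Unfolding lemma for `IsStrictlyDominantAt`. [folklore] -/
lemma isStrictlyDominantAt_iff (x : X.Pt) :
    X.IsStrictlyDominantAt x ↔ (X.param x).IsStrictlyDominant := Iff.rfl

/-- **`x` is `φ`-generic**: for every Weil–Deligne representation `r` attached to `r_x` through the
datum `𝔇` (intended `WD(D_pst(r_x))`; all are isomorphic, `𝔇.isEquivalent`) and every geometric
Frobenius `w ∈ W_K` (`deg w = -1`), the endomorphism `r(w)` — for crystalline `r_x` the linearised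
crystalline Frobenius `φ^{[K_0:ℚ_p]}` on `D_cris(r_x)`, up to the inversion fixed by the convention,
which the condition does not see — has pairwise distinct eigenvalues `φ_1, …, φ_n` with
`φ_iφ_j⁻¹ ≠ q` for `i ≠ j` (`q = #𝓀_K`), i.e. `φ_iφ_j⁻¹ ∉ {1, q}` for all `i ≠ j`.
[cite: BreuilHellmannSchraen2019, §1] [cite: BreuilHellmannSchraen2017Trianguline, Déf. 2.8] -/
def IsPhiGenericAt (𝔇 : PstWeilDeligneData K p) (x : X.Pt) : Prop :=
  ∀ r : WeilDeligneRep K (PadicAlgCl p) (Fin n → PadicAlgCl p),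
    𝔇.IsWeilDeligneOf (X.galoisRep x) r →
      ∀ w : WeilGroup K, WeilGroup.deg w = -1 →
        ((r.ρ w).charpoly.roots).Nodup ∧
          ∀ a ∈ (r.ρ w).charpoly.roots, ∀ b ∈ (r.ρ w).charpoly.roots, a ≠ b →
            a ≠ (IsNonarchimedeanLocalField.residueFieldCard K : PadicAlgCl p) * b

/-- **`x` is Borel-valued with its tautological parameter**: in some frame `P`, `r_x` is upper
triangular (accepted `FramedRep.IsUpperTriangular`: `r_x` stabilises the standard full flag), and
the ordered diagonal characters `χ_1, …, χ_n` (accepted `FramedRep.diagEntry`) are those named by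
`δ_x` through local class field theory: `δ_{x,i}(Art_K⁻¹(w)) = χ_i(w)` for all `w ∈ W_K`
(`d : LocalArtinData K`, the accepted local Artin datum `artin : W_K →* Kˣ`, geometric Frobenius ↦
uniformiser — BHS's normalisation of `rec_K`), i.e. `δ_{x,i} ∘ rec_K⁻¹ = χ_i`, the sub-character
first.  These are the points `(ρ, δ_taut(ρ))` whose Zariski closure is the locus `Z_B` excluded by
the corrected crux `IRR''`; for `n = 2`: `r_x` reducible and `δ_x` the tautological parameter.
[cite: BreuilHellmannSchraen2017Trianguline, Notations (p. 4, `rec_K`) and §2.2] -/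
def IsBorelValuedAt (d : LocalArtinData K) (x : X.Pt) : Prop :=
  ∃ P : GL (Fin n) (PadicAlgCl p), (FramedRep.conj P (X.galoisRep x)).IsUpperTriangular ∧
    ∀ (i : Fin n) (w : WeilGroup K),
      ((X.param x i (d.artin w) : (PadicAlgCl p)ˣ) : PadicAlgCl p) =
        FramedRep.diagEntry (FramedRep.conj P (X.galoisRep x)) i (WeilGroup.toAbsGalois K w)

/-- Unfolding lemma for `IsBorelValuedAt`, entrywise. [folklore] -/
lemma isBorelValuedAt_iff (d : LocalArtinData K) (x : X.Pt) :
    X.IsBorelValuedAt d x ↔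
      ∃ P : GL (Fin n) (PadicAlgCl p),
        (∀ (σ : absoluteGaloisGroup K) (i j : Fin n), j < i →
          (FramedRep.conj P (X.galoisRep x) σ : Matrix (Fin n) (Fin n) (PadicAlgCl p)) i j = 0) ∧
        ∀ (i : Fin n) (w : WeilGroup K),
          ((X.param x i (d.artin w) : (PadicAlgCl p)ˣ) : PadicAlgCl p) =
            (FramedRep.conj P (X.galoisRep x) (WeilGroup.toAbsGalois K w) :
              Matrix (Fin n) (Fin n) (PadicAlgCl p)) i i :=
  Iff.rfl

/-- **`x` has slope zero**: the first character `δ_{x,1}` of its parameter (the sub-object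
`𝓡(δ_{x,1}) = Fil¹`) is unitary — takes values of `p`-adic norm one — i.e. `v_p(δ_{x,1}(ϖ_K)) = 0`
for a (any) uniformiser (`δ_{x,1}(𝒪_Kˣ)` has norm one automatically, `𝒪_Kˣ` being compact): the
rank-one sub-`(φ, Γ_K)`-module is étale.  Vacuous for `n = 0`. [folklore] -/
def IsSlopeZeroAt (x : X.Pt) : Prop :=
  ∀ i : Fin n, (i : ℕ) = 0 → ∀ a : Kˣ, ‖((X.param x i a : (PadicAlgCl p)ˣ) : PadicAlgCl p)‖ = 1

/-- A continuous character of a compact group with values in `ℚ̄_pˣ` takes values of norm one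
(local copy of `norm_unitsChar_eq_one_of_continuous` of `CrystallineOrdinaryShape.lean`, kept
private to avoid importing that file). [folklore] -/
private theorem norm_unitsChar_eq_one {G : Type*} [Group G] [TopologicalSpace G] [CompactSpace G]
    (χ : G →* (PadicAlgCl p)ˣ) (hχ : Continuous fun g => (χ g : PadicAlgCl p)) (g : G) :
    ‖(χ g : PadicAlgCl p)‖ = 1 := by
  obtain ⟨C, hC⟩ := (isCompact_range hχ.norm).bddAbove
  have hle : ∀ g : G, ‖(χ g : PadicAlgCl p)‖ ≤ 1 := fun g => not_lt.mp fun hlt => by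
    obtain ⟨m, hm⟩ := pow_unbounded_of_one_lt C hlt
    have hm' : ‖(χ g : PadicAlgCl p)‖ ^ m ≤ C := by
      have := hC (Set.mem_range_self (g ^ m))
      simpa only [map_pow, Units.val_pow_eq_pow_val, norm_pow] using this
    exact absurd hm' (not_le.mpr hm)
  refine le_antisymm (hle g) ?_
  have h1 := hle g⁻¹
  rw [map_inv, Units.val_inv_eq_inv_val, norm_inv] at h1
  exact (inv_le_one₀ (norm_pos_iff.mpr (Units.ne_zero _))).mp h1

/-- **A Borel-valued point has unitary parameter**: every `δ_{x,i}` takes values of norm one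
(`δ_{x,i} ∘ Art_K⁻¹` is a diagonal character of the compact group `𝒢_K`, hence of norm one —
as for the accepted `IsUpperTriangular.norm_diagEntry_eq_one` — and `Art_K⁻¹ : W_K → Kˣ` is onto).
[folklore] -/
theorem IsBorelValuedAt.norm_param_eq_one {d : LocalArtinData K} {x : X.Pt}
    (h : X.IsBorelValuedAt d x) (i : Fin n) (a : Kˣ) :
    ‖((X.param x i a : (PadicAlgCl p)ˣ) : PadicAlgCl p)‖ = 1 := by
  obtain ⟨P, hP, hδ⟩ := h
  obtain ⟨w, rfl⟩ := d.artin_surjective a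
  haveI : CompactSpace (absoluteGaloisGroup K) := absoluteGaloisGroup_compactSpace K
  rw [hδ i w]
  exact norm_unitsChar_eq_one (hP.diagChar i)
    (FramedRep.continuous_diagEntry (FramedRep.conj P (X.galoisRep x)) i) _

/-- **The Borel-valued locus lies in the slope-zero locus** (`Z_B ⊆ {slope 0}` pointwise; the
inclusion "`⊆` is clear" of the route's support item `OrdinaryComponent`). [folklore] -/
theorem IsBorelValuedAt.isSlopeZeroAt {d : LocalArtinData K} {x : X.Pt}
    (h : X.IsBorelValuedAt d x) : X.IsSlopeZeroAt x :=
  fun i _ a => h.norm_param_eq_one X i a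

end PointPredicates

/-! #### Properties of the datum (hypotheses of the route, never fields) -/

section Properties

/-- **Equidimensionality (BHS Th. 2.6 (i))**: every irreducible component of `X_tri^□(ρ̄)` has
dimension `n² + [K:ℚ_p] · n(n+1)/2` — topological Krull dimension of the component for the analytic
Zariski topology, `[K:ℚ_p] = finrank ℚ_[p] K` for the `ℚ_p`-algebra structure in scope (the datum's
`𝔇.algebra` in the summit statement). [cite: BreuilHellmannSchraen2017Trianguline, Th. 2.6 (i)] -/
def IsEquidimensional [Algebra ℚ_[p] K] : Prop :=
  ∀ C ∈ irreducibleComponents X.Pt,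
    topologicalKrullDim C =
      ((n ^ 2 + Module.finrank ℚ_[p] K * (n * (n + 1) / 2) : ℕ) : WithBot ℕ∞)

/-- **`U_tri^□(ρ̄)^reg` is Zariski-open and Zariski-dense in `X_tri^□(ρ̄)` (BHS Th. 2.6 (ii))** —
density for the analytic Zariski topology is exactly BHS's "Zariski-dense" (Déf. 2.2 (i)).
A PREDICATE on the datum (the binder `X` is explicit: this is a property a given datum may or may
not have, consumed hypothesis-relatively as `(h : X.RegularIsOpenDense)` like the other properties
of this section, not a closed named fact).  It has no `_holds` companion and none can exist: no
axiom of the structure mentions `regular`, so the universal closure over the interface is false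
(rank `0`, one point, `regular = ∅` — `TriangulineVariety.not_forall_regularIsOpenDense` in the
sibling file `TriangulineVarietyProofs`), while "the genuine `X_tri^□(ρ̄)` has this property" is
Th. 2.6 (ii) itself, a construction statement awaiting rigid-analytic geometry (see the module
docstring, "Deliberately NOT here"). [cite: BreuilHellmannSchraen2017Trianguline, Th. 2.6 (ii)] -/
def RegularIsOpenDense (X : TriangulineVariety K p O k ρbar) : Prop :=
  IsOpen X.regular ∧ Dense X.regular

/-- **The points of the regular locus (BHS §2.2, definition of `U_tri^□(ρ̄)^reg`)**: a point `x`
lies in `regular` iff `δ_x ∈ 𝒯ⁿ_reg` (`CharacterTuple.IsRegular`) and `δ_x` is a parameter of `r_x`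
(`FramedGaloisRep.HasParameter 𝔇`, relative to the family `𝔇` of `(φ, Γ_K)`-module data —
intended: Robba rings and `D_rig^†`).  (By Rem. 2.5 the inclusion `U^reg ⊂ ω'⁻¹(𝒯ⁿ_reg)` is
strict: regular `δ_x` need not be a parameter of `r_x`.)
[cite: BreuilHellmannSchraen2017Trianguline, §2.2 and Rem. 2.5] -/
def PointsOfRegular
    (𝔇 : ∀ E : IntermediateField ℚ_[p] (PadicAlgCl p), FiniteDimensional ℚ_[p] E →
      PhiGammaModuleData.{0, 0, 0} p K E) : Prop :=
  ∀ x : X.Pt, x ∈ X.regular ↔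
    (X.param x).IsRegular ∧ FramedGaloisRep.HasParameter 𝔇 (X.galoisRep x) (X.param x)

/-- **Every regular trianguline pair is a point (BHS §2.2, Déf. 2.4)**: for every `O`-integral lift
`r` of `ρ̄` (a `ℚ̄_p`-point of `𝔛^□_ρ̄`) and every `δ ∈ 𝒯ⁿ_reg` which is a parameter of `r`, the
pair `(r, δ)` is a point of `regular` — `U_tri^□(ρ̄)^reg` is the set of ALL such pairs, and
`X_tri^□(ρ̄)` contains it. [cite: BreuilHellmannSchraen2017Trianguline, §2.2 and Déf. 2.4] -/
def HasAllRegularPoints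
    (𝔇 : ∀ E : IntermediateField ℚ_[p] (PadicAlgCl p), FiniteDimensional ℚ_[p] E →
      PhiGammaModuleData.{0, 0, 0} p K E) : Prop :=
  ∀ (r : FramedGaloisRep K (PadicAlgCl p) n) (δ : CharacterTuple K (PadicAlgCl p) n),
    ReducesTo O r.toMonoidHom ρbar.toMonoidHom → δ.IsRegular → FramedGaloisRep.HasParameter 𝔇 r δ →
      ∃ x ∈ X.regular, X.galoisRep x = r ∧ X.param x = δ

/-- **The Borel-valued closure is clopen and is the slope-zero locus** — the property asserted by
the route's support item `OrdinaryComponent` (not a statement of BHS): the Zariski closure `Z_B` of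
the Borel-valued points (`IsBorelValuedAt d`) is Zariski open and closed — equivalently a union of
irreducible components meeting no other component — and coincides with the slope-zero locus
(`IsSlopeZeroAt`; Kedlaya's slope filtration: an étale saturated rank-one sub-object with étale
quotient comes from a sub-representation).  A hypothesis schema for the route, recorded as a
predicate. [folklore] -/
def BorelLocusClopen (d : LocalArtinData K) : Prop :=
  IsClopen (closure {x | X.IsBorelValuedAt d x}) ∧
    closure {x | X.IsBorelValuedAt d x} = {x | X.IsSlopeZeroAt x}

/-- Under `PointsOfRegular`, membership in the regular locus unfolds to the BHS condition.
[folklore] -/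
lemma mem_regular_iff
    {𝔇 : ∀ E : IntermediateField ℚ_[p] (PadicAlgCl p), FiniteDimensional ℚ_[p] E →
      PhiGammaModuleData.{0, 0, 0} p K E}
    (h : X.PointsOfRegular 𝔇) (x : X.Pt) :
    x ∈ X.regular ↔
      (X.param x).IsRegular ∧ FramedGaloisRep.HasParameter 𝔇 (X.galoisRep x) (X.param x) :=
  h x

/-- Under `HasAllRegularPoints` and `PointsOfRegular`, the regular points are in bijection with the
regular trianguline pairs `(r, δ)`: existence and uniqueness of the point with given `(r, δ)`
(uniqueness from `injective`). [folklore] -/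
theorem existsUnique_of_hasAllRegularPoints
    {𝔇 : ∀ E : IntermediateField ℚ_[p] (PadicAlgCl p), FiniteDimensional ℚ_[p] E →
      PhiGammaModuleData.{0, 0, 0} p K E}
    (h : X.HasAllRegularPoints 𝔇) {r : FramedGaloisRep K (PadicAlgCl p) n}
    {δ : CharacterTuple K (PadicAlgCl p) n} (hr : ReducesTo O r.toMonoidHom ρbar.toMonoidHom)
    (hδ : δ.IsRegular) (hpar : FramedGaloisRep.HasParameter 𝔇 r δ) :
    ∃! x : X.Pt, X.galoisRep x = r ∧ X.param x = δ := by
  obtain ⟨x, -, hx⟩ := h r δ hr hδ hpar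
  refine ⟨x, hx, fun y hy => X.injective ?_⟩
  simp only [hx.1, hx.2, hy.1, hy.2]

/-- Under `BorelLocusClopen`, every irreducible component is either contained in the Borel-valued
closure `Z_B` or disjoint from it (an irreducible set is preconnected and `Z_B` is clopen) — the
dichotomy "`X_tri^□(ρ̄) = Z_B ⊔ X_{>0}` componentwise" behind the corrected crux. [folklore] -/
theorem subset_or_disjoint_of_borelLocusClopen {d : LocalArtinData K} (h : X.BorelLocusClopen d)
    {C : Set X.Pt} (hC : C ∈ irreducibleComponents X.Pt) :
    C ⊆ closure {x | X.IsBorelValuedAt d x} ∨ Disjoint C (closure {x | X.IsBorelValuedAt d x}) := by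
  have hpre : IsPreconnected C := hC.1.isPreirreducible.isPreconnected
  by_cases hne : (C ∩ closure {x | X.IsBorelValuedAt d x}).Nonempty
  · exact Or.inl (hpre.subset_isClopen h.1 hne)
  · exact Or.inr (Set.disjoint_iff_inter_eq_empty.mpr (Set.not_nonempty_iff_eq_empty.mp hne))

end Properties

end TriangulineVariety

end Literature.NumberTheory.GaloisRepresentations

end
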